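import Mathlib
import Literature.AlgebraicGeometry.Resolution.CobordantGame
import Literature.AlgebraicGeometry.Resolution.FormalInverseFunction
import Summits.ResolutionOfSingularities.ResolutionOfSingularities.Theorems.WeightedInvariantLocalWeightedDropGradedGameCylinder
import Summits.ResolutionOfSingularities.ResolutionOfSingularities.Theorems.WeightedInvariantLocalWeightedDropGradedGameUnit
import Summits.ResolutionOfSingularities.ResolutionOfSingularities.Theorems.WeightedInvariantLocalWeightedDropGradedGameCoordChange

/-!
# `WeightedInvariant.LocalWeightedDrop`: SLICE ⇒ SUCCESSOR with the same graded rank, from a graded TRIVIALIZATION over the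
# cylinder of the slice (the surviving one-sided slice statement, abstract tame form)

Route `ResolutionOfSingularities/WeightedInvariant`, crux `LocalWeightedDrop` (stmt-ResolutionOfSingularities-8899).
[OURS · L1 W4.3] — CHAIN w43 SEAT TABLE v7 row res-type-060 «idea-1's graded slices».  The probe of R3-T3 (`…GradedSliceRank`
p507692 … `…GradedFrobeniusLineRankOne` p510443) left the ONE-SIDED slice statement T3″ («slice graded-won ⇒ successor graded-won,
rank non-increasing») standing; this file ASSEMBLES its abstract tame form from the three transfers of the graded game —
cylinder (`…GradedGameCylinder` p511529), unit (`…GradedGameUnit` p512265), graded coordinate change (`…GradedGameCoordChange`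
p512731): whenever the successor `g` is trivialized over the cylinder of its slice by graded data, the graded rank of `g` is at
most that of its slice.  What is NOT here: the exhibition of the trivialization at a tame exceptional point (the orbit lemma
`wildSlice_pullback`, p500270, read through `μ ↦ v` and inverted; `Λ` is invertible iff `p ∤ w_v`) — left to the holder of the
orbit kit; and nothing for WILD points, where `…GradedSliceNoOneMoveWin` shows the rank genuinely shifts.  Frozen coordinate =
the LAST one (general slot by relabelling, not done).  Nothing here is a statement of the manuscript under review on ladder
RESOLUTION; not a verdict on card A.  AI proof, weaker than expert review.

* `mem_sliceLattice_last_iff`, `cylLattice_sliceLattice_last_le` — at the last coordinate the slice lattice is restriction along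
  `castSucc`; if `e_last ∈ L` then `cylLattice (sliceLattice L last) ≤ L`.
* `gradedWonBy_of_slice_of_trivialization` — **`GradedWonBy α (n+1) (sliceLattice L last) (sliceGerm last g) →
  GradedWonBy α (n+2) L g`** given `e_last ∈ L`, an `L`-graded coordinate change `Λ` (zero constants, invertible linear part), a
  unit `u`, a substitution `Tw` with an `L`-graded left inverse `Tw'`, and the identity `g(Λ) = u · (cylinder (sliceGerm last g))(Tw)`.
  (Only `Λ` itself needs to be graded: the transfer back runs along its formal inverse `FormalCoordChange.exists_comp_inverse` with
  `Λ` as the graded left inverse.)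
-/

set_option linter.dupNamespace false -- mandated namespace of this single-conjunct summit
set_option autoImplicit false

namespace Summit.ResolutionOfSingularities.ResolutionOfSingularities.Theorems

namespace GradedGame

open MvPowerSeries
open Literature.AlgebraicGeometry.Resolution
open Literature.AlgebraicGeometry.Resolution.FormalCoordChange (linMat exists_comp_inverse)

variable {k : Type} [Field k]

/-- The slice lattice at the LAST coordinate is the restriction along `Fin.castSucc`. [OURS · L1 W4.3] -/
theorem mem_sliceLattice_last_iff {n : ℕ} (L : AddSubgroup (Fin (n + 1 + 1) → ℤ)) (u : Fin (n + 1) → ℤ) :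
    u ∈ sliceLattice L (Fin.last n) ↔ ∃ v ∈ L, (fun j => v (Fin.castSucc j)) = u := by
  rw [mem_sliceLattice_iff]
  have : (Fin.last n).succ.succAbove = (Fin.castSucc : Fin (n + 1) → Fin (n + 1 + 1)) := by
    rw [Fin.succ_last, Fin.succAbove_last]
  simp only [this]

/-- If the last coordinate has trivial character (`e_last ∈ L`), the cylinder of the slice lattice at the last coordinate is
contained in (indeed equals) `L`. [OURS · L1 W4.3] -/
theorem cylLattice_sliceLattice_last_le {n : ℕ} (L : AddSubgroup (Fin (n + 1 + 1) → ℤ))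
    (hlast : (Pi.single (Fin.last (n + 1)) 1 : Fin (n + 1 + 1) → ℤ) ∈ L) :
    cylLattice (sliceLattice L (Fin.last n)) ≤ L := by
  intro v hv
  rw [mem_cylLattice_iff, mem_sliceLattice_last_iff] at hv
  obtain ⟨u, hu, huv⟩ := hv
  have hdec : v = u + (v (Fin.last (n + 1)) - u (Fin.last (n + 1))) • (Pi.single (Fin.last (n + 1)) 1 : Fin (n + 1 + 1) → ℤ) := by
    funext i
    refine Fin.lastCases ?_ (fun l => ?_) i
    · simp
    · have hl : u (Fin.castSucc l) = v (Fin.castSucc l) := congrFun huv l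
      rw [Pi.add_apply, Pi.smul_apply, Pi.single_eq_of_ne (Fin.castSucc_lt_last l).ne, smul_zero, add_zero, hl]
  rw [hdec]
  exact L.add_mem hu (L.zsmul_mem hlast _)

/-- **SLICE ⇒ SUCCESSOR FROM A GRADED TRIVIALIZATION (same rank).**  Let `g ∈ k[[s, y₁..yₙ, v]]` be graded by `L` with the
last coordinate `v` of trivial character (`e_v ∈ L` — at an exceptional point `c` with `c_v ≠ 0 < w_v` this holds for the
propagated lattice), and suppose `g` is TRIVIALIZED over the cylinder of its slice `h = g|_{v=0}`: `g(Λ) = u · (h ⊗ 1)(Tw)` for an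
`L`-graded coordinate change `Λ` (zero constants, invertible linear part), a unit `u`, and a substitution `Tw` with an `L`-graded
left inverse `Tw'`.  Then `GradedWonBy α _ (sliceLattice L v) h → GradedWonBy α _ L g`.  Proof = cylinder lemma (p511529) +
lattice monotonicity + coordinate-change transfer for `Tw` (p512731) + unit transfer (p512265) + coordinate-change transfer back
along the formal inverse of `Λ` (`FormalCoordChange.exists_comp_inverse`; only `Λ` itself needs to be graded).  At a TAME
exceptional point the orbit lemma (`wildSlice_pullback`, p500270) provides exactly such a trivialization
(`Λ = (s, (1+v)^{wⱼ}(cⱼ + yⱼ) − cⱼ, c_v((1+v)^{w_v} − 1))`, `u = (1+v)^a`, `Tw = ((1+v)s, y, v)`, invertible iff `p ∤ w_v`);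
exhibiting it is left to the holder of the orbit kit. [OURS · L1 W4.3] -/
theorem gradedWonBy_of_slice_of_trivialization (α : Ordinal.{0}) {n : ℕ} (L : AddSubgroup (Fin (n + 1 + 1) → ℤ))
    (g : MvPowerSeries (Fin (n + 1 + 1)) k) (hlast : (Pi.single (Fin.last (n + 1)) 1 : Fin (n + 1 + 1) → ℤ) ∈ L)
    (Λ Tw Tw' : Fin (n + 1 + 1) → MvPowerSeries (Fin (n + 1 + 1)) k) (u : MvPowerSeries (Fin (n + 1 + 1)) k) (hu : IsUnit u)
    (hΛ0 : ∀ j, constantCoeff (Λ j) = 0) (hΛdet : IsUnit (linMat Λ).det)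
    (hΛgr : ∀ j (e : Fin (n + 1 + 1) →₀ ℕ), coeff e (Λ j) ≠ 0 → expVec e - Pi.single j 1 ∈ L)
    (hTw0 : ∀ j, constantCoeff (Tw j) = 0) (hTw'0 : ∀ j, constantCoeff (Tw' j) = 0) (hTw'det : IsUnit (linMat Tw').det)
    (hTw'gr : ∀ j (e : Fin (n + 1 + 1) →₀ ℕ), coeff e (Tw' j) ≠ 0 → expVec e - Pi.single j 1 ∈ L)
    (hTwinv : ∀ j, subst Tw' (Tw j) = X j)
    (htriv : subst Λ g = u * subst Tw (cylinder (sliceGerm (Fin.last n) g))) :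
    GradedWonBy α (n + 1) (sliceLattice L (Fin.last n)) (sliceGerm (Fin.last n) g) → GradedWonBy α (n + 1 + 1) L g := by
  intro hh
  -- the cylinder of the slice is graded-won for `L`
  have h1 := gradedWonBy_cylinder α _ _ hh
  have h2 : GradedWonBy α (n + 1 + 1) L (cylinder (sliceGerm (Fin.last n) g)) :=
    GradedWonBy.mono_lattice α (cylLattice_sliceLattice_last_le L hlast) h1
  -- transport along `Tw`, multiply by the unit
  have h3 := gradedWonBy_subst_of_leftInverse α L _ Tw Tw' hTw0 hTw'0 hTw'det hTw'gr hTwinv h2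
  have h4 := gradedWonBy_unit_mul α L _ u hu h3
  rw [← htriv] at h4
  -- transport back along the formal inverse of `Λ`
  obtain ⟨Ψ, hΨ0, hΨ1, hΨ2⟩ := exists_comp_inverse hΛ0 hΛdet
  have hΛs : HasSubst Λ := hasSubst_of_constantCoeff_zero hΛ0
  have hΨs : HasSubst Ψ := hasSubst_of_constantCoeff_zero hΨ0
  have h5 := gradedWonBy_subst_of_leftInverse α L (subst Λ g) Ψ Λ hΨ0 hΛ0 hΛdet hΛgr hΨ2 h4
  have hback : subst Ψ (subst Λ g) = g := by
    rw [subst_comp_subst_apply hΛs hΨs]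
    have : (fun j => subst Ψ (Λ j)) = X := by funext j; exact hΨ1 j
    rw [this, subst_self]
    rfl
  rwa [hback] at h5

end GradedGame

end Summit.ResolutionOfSingularities.ResolutionOfSingularities.Theorems
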